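/-
Copyright (c) 2026 the pub-hodgecm-mathlib formalisation cell (harness21).  Prover seat hodgecm-mathlib-R90-C10-p08 (g3), R90-TF SLAB section S1 «Ch10-local» (base
R90-C10), h413 = `stmt-HodgeConjecture-24833`; line «U4Keys :182 — THE WILD CORNER (S-W)», brick (W-2c) «THE CHARACTER MASSES ON THE FIXED UNITS AT A WILD PLACE»
(scout `R90/R90-C10-p08/g3/SCOUT-PWILD1.v1.md` 03536fd8115e96cf items (M1)(M2); sequel of ★ p865073 (W-2) `R90S1WildUnitNormIndex`).  2026-09-05.
-/
import Summits.HodgeConjecture.HodgeConjecture.Theorems.R90S1WildUnitNormIndex        -- ★ p865073 (W-2, this seat): `apply_eq_one_of_fixed_of_valued_sub_one_le` (conductor ≤ d), `exists_fixed_near_one_apply_eq_neg_one` (the `−1` witness at level `2(d−1)`); brings the `hD` currency, ★ `isClopen_setOf_valued_le_valued`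
import Summits.HodgeConjecture.HodgeConjecture.Theorems.R90S1BposRamFixedUnitsHaar       -- ★ p864287 (R90-C10-p06 (g3)): `measurePreserving_smulFixed_of_valued_eq_one`, `isUnit_of_valued_eq_one`; brings ★ `dite_chi_units_mul`, the `R⁺`-Haar frame
import HarnessLib

/-!
# R90-TF S1 «Ch10-local» ∕ U4Keys :182, THE WILD CORNER — brick (W-2c): the MASSES of `E = χ₁(·̂)` on the balls `x₀ + B⁺_j` of the fixed units at a ramified place:
# CONSTANT `χ₁(x₀)·ν(x₀ + B⁺_j)` at depth `j ≥ 2d − 1`, ZERO at depth `j ≤ 2(d − 1)` — the measure form of the conductor-`d` character sums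
# (Serre, *Corps locaux* XV §2; ★ `WildQuadraticDatum.sum_normSign_eq_card_mul_of_near` ∕ `sum_normSign_repr_eq_zero` are the finite-sum twins)

Cell `pub/hodgecm-mathlib`, crux H413 = `stmt-HodgeConjecture-24833`, route of record `HCCMUnconditional` (no route verbs); lane `--supports stmt-HodgeConjecture-24833 --as helper`,
count-neutral.  THEOREMS ONLY (no `def`, no `instance`, no `notation`, no named-fact hypothesis, no `sorry`); ★-only imports.  NOT THE PAYER of :182 ∕ (S-W).

FRAME (= ★ `R90S1BposRamFixedUnitsHaar` + ★ (W-2)).  `w ∣ v` non-split (`hw`), `R = LocalRing L v`, `σ = conjLocal`, `R⁺ = HeisRing.fixedPart σ` with a regular additive Haar measure `ν`,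
`E r := if IsUnit r then χ₁ r̂ else 0` (the (G·) files' integrand, spelled inline), letters `(hB) (hFε)` BYTE-IDENTICAL to ★ (7a) `R90S1BposRamConversion` :62–65, the place datum
`hD : IsRamifiedQuadraticDatum σ_w ϖ d t` (★ `F0P3cDyRamWildPlaceDatum.exists_isRamifiedQuadraticDatum_of_placesOver`), `x₀ ∈ U_F` a `σ`-fixed unit of modulus one, and the BALL
`x₀ + B⁺_j := {c : R⁺ | |(c − x₀)_w| ≤ |ϖ|^j}` (for `j ≥ 1` it lies inside the fixed units `C`; fixed elements have even order, so only even `j` give new sets).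

WHAT IS PROVED (scout (M1)(M2); the outer masses of the `j`-sliced wild Gauss square, P-WILD-1 §«Lean inputs»):
* §0 the ball is closed ∕ measurable; its points are units of modulus one; `ĉ·x₀⁻¹ ≡ 1 (mod ϖ^j)`.
* §1 (M1) DEEP BALLS `j ≥ 2d − 1`: `E ≡ χ₁(x₀)` on `x₀ + B⁺_j` (★ (W-2) conductor `≤ d`), hence **`setIntegral_nearBall_dite_eq_of_le`**: `∫_{x₀ + B⁺_j} E dν = ν.real(x₀ + B⁺_j)·χ₁(x₀)`.
* §2 (M2) SHALLOW BALLS `j ≤ 2(d − 1)` (no fixedness of `x₀` needed): **`setIntegral_nearBall_dite_eq_zero_of_le`**: `∫_{x₀ + B⁺_j} E dν = 0` — the ★ (W-2) witness `u ≡ 1 (mod ϖ^{2(d−1)})` with `χ₁ u = −1` maps the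
  ball to itself and preserves `ν` (★ `measurePreserving_smulFixed_of_valued_eq_one`), and `E(u·c) = χ₁(u)·E(c)` (★ `dite_chi_units_mul`), so `I = −I`.
* §3 the `x₀ = −1` readings in the (G·) files' `T`-spelling `{e | |(1 + e)_w| ≤ |ϖ|^j}` (the wild family of thresholds replacing ★ `GaussSquareModLetters`' single `T = −1 + 𝔪⁺`):
  `∫ E = ν.real·χ₁(−1)` for `j ≥ 2d − 1`, `= 0` for `j ≤ 2(d − 1)`.
* §4 the type-side corollary **`two_mul_pred_add_one_le_of_cond`**: the organ's `hcond` letter at level `n` forces `2(d − 1) + 1 ≤ n` in (R-b) (`cond_E χ₁ ≥ 2δ + 1`, the `hn` letter of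
  the (R-b) concave level datum; `hcondF` at level `2d − 1` is ★ (W-2) `apply_eq_one_of_fixed_of_valued_sub_one_le` by `exact`).
HONEST LABEL.  HC_CM is proved only modulo the 7 printed citations (2 remaining named inputs: hLiu418 = `stmt-HodgeConjecture-24832`, h413 = `stmt-HodgeConjecture-24833`) until rung 0
closes; (W-2c) is infrastructure of the (R-b)-wild determinant road (P-WILD-1) and pays NO socket; (S-W) stays the XL residual of :182; REL ≠ ★ ≠ BUILT.

## References
* [Serre1979] J.-P. Serre, *Local Fields*, GTM 67 (1979), Ch. V §3 Prop. 5 Cor. 2–3 pp. 84–86, Ch. XV §2 (conductor of the norm residue symbol).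
* [WeilBNT1967] A. Weil, *Basic Number Theory* (1967), Ch. I §2, Ch. II §5 (Haar measure of a local field, substitution by units).
* [Keys1984] D. Keys, *Principal series representations of special unitary groups over local fields*, Compositio Math. 51 (1984), §4–§5, §7 Theorem (2) (d) p. 126.
* [Rogawski1990] J. D. Rogawski, *Automorphic Representations of Unitary Groups in Three Variables*, Ann. of Math. Stud. 123 (1990), §4.8 p. 51, §12.2 (2) p. 173.
-/

set_option autoImplicit false
-- the mandated namespace has the single-problem summit's repeated segment (`HodgeConjecture.HodgeConjecture`)
set_option linter.dupNamespace false

noncomputable section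

open NumberField IsDedekindDomain MeasureTheory Measure Topology Set
open scoped NNReal ENNReal Valued
open Literature.NumberTheory Literature.NumberTheory.Automorphic Literature.NumberTheory.Automorphic.UnitaryGroup
open Literature.NumberTheory.Automorphic.UnitaryThreeFourFrame (IsRamifiedQuadraticDatum)
open Literature.NumberTheory.LocalFields
open Summit.HodgeConjecture.HodgeConjecture.Cruxes.H413
open Summit.HodgeConjecture.HodgeConjecture.Cruxes.H413.K2E3BranchBSkewLineCharacterIntegral
open Summit.HodgeConjecture.HodgeConjecture.R90.S1.WildUnitNormIndex Summit.HodgeConjecture.HodgeConjecture.R90.S1.BposRamFixedUnitsHaar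

namespace Summit.HodgeConjecture.HodgeConjecture.R90.S1.WildFixedUnitCharacterMasses

variable (L : Type) [Field L] [NumberField L] [IsCMField L] (v : HeightOneSpectrum (𝓞 ↥(maximalRealSubfield L)))
  (w : PlacesOver L v) (hw : IsCMField.complexConj L • w.1 = w.1)

/-! ## §0 The ball `x₀ + B⁺_j` around a fixed unit of modulus one -/

omit [IsCMField L] in
/-- In `ℤᵐ⁰`: `|ϖ|^j < 1` for a uniformiser and `j ≥ 1`. [cite: Serre1979, Ch. II §1] -/
private theorem varpi_pow_lt_one {ϖ : w.1.adicCompletion L} (hϖ : Valued.v ϖ = WithZero.exp (-1 : ℤ)) {j : ℕ} (hj : 1 ≤ j) : Valued.v ϖ ^ j < 1 := by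
  rw [WildQuadraticDatum.v_varpi_pow hϖ j, ← WithZero.exp_zero, WithZero.exp_lt_exp]; omega

omit [IsCMField L] in
/-- In `ℤᵐ⁰`: `|ϖ|^a ≤ |ϖ|^b` for `b ≤ a`. [cite: Serre1979, Ch. II §1] -/
private theorem varpi_pow_le_varpi_pow {ϖ : w.1.adicCompletion L} (hϖ : Valued.v ϖ = WithZero.exp (-1 : ℤ)) {a b : ℕ} (h : b ≤ a) :
    Valued.v ϖ ^ a ≤ Valued.v ϖ ^ b := by
  rw [WildQuadraticDatum.v_varpi_pow hϖ a, WildQuadraticDatum.v_varpi_pow hϖ b, WithZero.exp_le_exp]; omega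

omit [IsCMField L] in
/-- Ultrametric bookkeeping: if `|a_w| = 1`, `|(a − 1)_w| ≤ γ`, `|x₀,w| = 1` and `|(c − x₀)_w| ≤ γ` then `|(a·c − x₀)_w| ≤ γ` (`ac − x₀ = a(c − x₀) + (a − 1)x₀`). [cite: Serre1979, Ch. II §1] -/
private theorem valued_mul_sub_apply_le {a c x₀ : LocalRing L v} {γ : WithZero (Multiplicative ℤ)} (ha1 : Valued.v (a w) = 1)
    (ha : Valued.v ((a - 1) w) ≤ γ) (hx₀ : Valued.v (x₀ w) = 1) (hc : Valued.v ((c - x₀) w) ≤ γ) : Valued.v ((a * c - x₀) w) ≤ γ := by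
  have e : (a * c - x₀) w = a w * (c - x₀) w + (a - 1) w * x₀ w := by simp only [Pi.sub_apply, Pi.mul_apply, Pi.one_apply]; ring
  rw [e]
  refine (Valuation.map_add _ _ _).trans (max_le ?_ ?_)
  · rw [map_mul, ha1, one_mul]; exact hc
  · rw [map_mul, hx₀, mul_one]; exact ha

/-- **The ball `{c ∈ R⁺ : |(c − x₀)_w| ≤ |ϖ|^j}` is measurable** (closed-open: preimage of the clopen ball of `L_w` under the continuous `c ↦ (c − x₀)_w`). [cite: WeilBNT1967, Ch. I §2] -/
theorem measurableSet_nearBall [MeasurableSpace (LocalRing L v)] [BorelSpace (LocalRing L v)] {ϖ : w.1.adicCompletion L} (hϖ : Valued.v ϖ = WithZero.exp (-1 : ℤ))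
    (x₀ : LocalRing L v) (j : ℕ) :
    MeasurableSet {c : ↥(HeisRing.fixedPart (conjLocal L (IsCMField.complexConj L) v)) | Valued.v (((c : LocalRing L v) - x₀) w) ≤ Valued.v ϖ ^ j} := by
  have hϖ0 : ϖ ≠ 0 := fun h0 => by rw [h0, map_zero] at hϖ; exact WithZero.zero_ne_coe hϖ
  have h : {c : ↥(HeisRing.fixedPart (conjLocal L (IsCMField.complexConj L) v)) | Valued.v (((c : LocalRing L v) - x₀) w) ≤ Valued.v ϖ ^ j} =
      (fun c : ↥(HeisRing.fixedPart (conjLocal L (IsCMField.complexConj L) v)) => ((c : LocalRing L v) - x₀) w) ⁻¹'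
        {z : w.1.adicCompletion L | Valued.v z ≤ Valued.v (ϖ ^ j)} := by
    ext c; rw [Set.mem_preimage, Set.mem_setOf_eq, Set.mem_setOf_eq, map_pow]
  rw [h]
  exact ((isClopen_setOf_valued_le_valued L v w (pow_ne_zero j hϖ0)).preimage
    ((continuous_apply w).comp (continuous_subtype_val.sub continuous_const))).isClosed.measurableSet

include hw in
/-- **Points of the ball are units of modulus one with `ĉ·x₀⁻¹ ≡ 1 (mod ϖ^j)`**: for `x₀ ∈ U_F`, `j ≥ 1` and a fixed `c` with `|(c − x₀)_w| ≤ |ϖ|^j`: `|c_w| = 1`, and the unit `ĉ·x₀⁻¹` is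
`σ`-fixed with `|(ĉ·x₀⁻¹ − 1)_w| ≤ |ϖ|^j`. [cite: Serre1979, Ch. XV §2] -/
theorem nearBall_facts {ϖ : w.1.adicCompletion L} (hϖ : Valued.v ϖ = WithZero.exp (-1 : ℤ))
    (x₀ : (LocalRing L v)ˣ) (hσx₀ : Units.map (conjLocal L (IsCMField.complexConj L) v : LocalRing L v →* LocalRing L v) x₀ = x₀)
    (hx₀ : ∀ w' : PlacesOver L v, Valued.v ((x₀ : LocalRing L v) w') = 1) {j : ℕ} (hj : 1 ≤ j)
    {c : LocalRing L v} (hσc : conjLocal L (IsCMField.complexConj L) v c = c) (hc : Valued.v ((c - x₀) w) ≤ Valued.v ϖ ^ j) :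
    ∃ hcu : Valued.v (c w) = 1,
      Units.map (conjLocal L (IsCMField.complexConj L) v : LocalRing L v →* LocalRing L v) ((isUnit_of_valued_eq_one L v w hw hcu).unit * x₀⁻¹) =
          (isUnit_of_valued_eq_one L v w hw hcu).unit * x₀⁻¹ ∧
        Valued.v (((((isUnit_of_valued_eq_one L v w hw hcu).unit * x₀⁻¹ : (LocalRing L v)ˣ) : LocalRing L v) w) - 1) ≤ Valued.v ϖ ^ j := by
  have hlt : Valued.v ((c - x₀) w) < 1 := lt_of_le_of_lt hc (varpi_pow_lt_one L v w hϖ hj)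
  have hcu : Valued.v (c w) = 1 := by
    have e : c w = (x₀ : LocalRing L v) w + (c - x₀) w := by rw [Pi.sub_apply]; ring
    rw [e, Valuation.map_add_eq_of_lt_left _ (by rw [hx₀ w]; exact hlt), hx₀ w]
  refine ⟨hcu, ?_, ?_⟩
  · have hσx₀' : conjLocal L (IsCMField.complexConj L) v (x₀ : LocalRing L v) = x₀ := by
      have h := congrArg (fun u : (LocalRing L v)ˣ => (u : LocalRing L v)) hσx₀
      simpa only [Units.coe_map, MonoidHom.coe_coe] using h
    refine Units.ext ?_
    rw [Units.coe_map, MonoidHom.coe_coe, Units.val_mul, map_mul, IsUnit.unit_spec, hσc]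
    congr 1
    exact HeisRing.map_units_inv_of_fixed (conjLocal L (IsCMField.complexConj L) v) x₀ hσx₀'
  · have hx0 : (x₀ : LocalRing L v) w ≠ 0 := fun h0 => zero_ne_one (by rw [← hx₀ w, h0, map_zero])
    have e : (((isUnit_of_valued_eq_one L v w hw hcu).unit * x₀⁻¹ : (LocalRing L v)ˣ) : LocalRing L v) w - 1 = (c - x₀) w * ((x₀ : LocalRing L v) w)⁻¹ := by
      rw [Units.val_mul, Pi.mul_apply, IsUnit.unit_spec, Units.val_inv_eq_inv_val, Pi.inv_apply, Pi.sub_apply]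
      field_simp
    rw [e, map_mul, map_inv₀, hx₀ w, inv_one, mul_one]
    exact hc

/-! ## §1 (M1) Deep balls `j ≥ 2d − 1`: `E` is constant `χ₁(x₀)`, mass `ν(x₀ + B⁺_j)·χ₁(x₀)` -/

open scoped Classical in
include hw in
/-- **`E(c) = χ₁(x₀)` ON THE DEEP BALL**: for `x₀ ∈ U_F`, `j ≥ 2d − 1` and a fixed `c` with `|(c − x₀)_w| ≤ |ϖ|^j`, `χ₁(ĉ) = χ₁(x₀)` — `ĉ·x₀⁻¹ ≡ 1 (mod ϖ^j)` is killed by ★ (W-2)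
`apply_eq_one_of_fixed_of_valued_sub_one_le` (conductor `≤ d`, `hB`). [cite: Serre1979, Ch. V §3 Prop. 5 Cor. 3; Ch. XV §2] [cite: Keys1984, §7 Theorem (2) (d) p. 126] -/
theorem dite_eq_of_near (χ₁ : (LocalRing L v)ˣ →* ℂˣ)
    (hB : ∀ u : (LocalRing L v)ˣ, (∀ w' : PlacesOver L v, Valued.v ((u : LocalRing L v) w') = 1) →
      χ₁ (u * Units.map (conjLocal L (IsCMField.complexConj L) v : LocalRing L v →* LocalRing L v) u) = 1)
    {ϖ : w.1.adicCompletion L} {d t : ℕ} (hD : IsRamifiedQuadraticDatum (galAdicCompletionMap (L := L) (IsCMField.complexConj L) hw) ϖ d t)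
    (x₀ : (LocalRing L v)ˣ) (hσx₀ : Units.map (conjLocal L (IsCMField.complexConj L) v : LocalRing L v →* LocalRing L v) x₀ = x₀)
    (hx₀ : ∀ w' : PlacesOver L v, Valued.v ((x₀ : LocalRing L v) w') = 1) {j : ℕ} (hj : 2 * d - 1 ≤ j)
    {c : LocalRing L v} (hσc : conjLocal L (IsCMField.complexConj L) v c = c) (hc : Valued.v ((c - x₀) w) ≤ Valued.v ϖ ^ j) :
    (fun r : LocalRing L v => if h : IsUnit r then ((χ₁ h.unit : ℂˣ) : ℂ) else 0) c = ((χ₁ x₀ : ℂˣ) : ℂ) := by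
  have hd1 : 1 ≤ d := hD.2.2.2.2.2.1
  obtain ⟨hcu, hσu, hu⟩ := nearBall_facts L v w hw hD.2.2.1 x₀ hσx₀ hx₀ (by omega) hσc hc
  have h1 : χ₁ ((isUnit_of_valued_eq_one L v w hw hcu).unit * x₀⁻¹) = 1 :=
    apply_eq_one_of_fixed_of_valued_sub_one_le L v w hw χ₁ hB hD hσu hj hu
  have hχc : χ₁ (isUnit_of_valued_eq_one L v w hw hcu).unit = χ₁ x₀ := by
    rw [map_mul, map_inv, mul_inv_eq_one] at h1; exact h1
  beta_reduce
  rw [dif_pos (isUnit_of_valued_eq_one L v w hw hcu), hχc]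

section Haar

variable [MeasurableSpace (LocalRing L v)] [BorelSpace (LocalRing L v)]
  (ν : Measure ↥(HeisRing.fixedPart (conjLocal L (IsCMField.complexConj L) v))) [ν.IsAddHaarMeasure] [ν.Regular]

open scoped Classical in
omit [ν.IsAddHaarMeasure] [ν.Regular] in
include hw in
/-- **(M1) `∫_{x₀ + B⁺_j} E dν = ν.real(x₀ + B⁺_j) · χ₁(x₀)` for `j ≥ 2d − 1`** (`x₀ ∈ U_F`; `E` is the constant `χ₁(x₀)` on the ball, §1) — the measure form of ★
`WildQuadraticDatum.sum_normSign_eq_card_mul_of_near`. [cite: Serre1979, Ch. XV §2] [cite: WeilBNT1967, Ch. II §5] -/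
theorem setIntegral_nearBall_dite_eq_of_le (χ₁ : (LocalRing L v)ˣ →* ℂˣ)
    (hB : ∀ u : (LocalRing L v)ˣ, (∀ w' : PlacesOver L v, Valued.v ((u : LocalRing L v) w') = 1) →
      χ₁ (u * Units.map (conjLocal L (IsCMField.complexConj L) v : LocalRing L v →* LocalRing L v) u) = 1)
    {ϖ : w.1.adicCompletion L} {d t : ℕ} (hD : IsRamifiedQuadraticDatum (galAdicCompletionMap (L := L) (IsCMField.complexConj L) hw) ϖ d t)
    (x₀ : (LocalRing L v)ˣ) (hσx₀ : Units.map (conjLocal L (IsCMField.complexConj L) v : LocalRing L v →* LocalRing L v) x₀ = x₀)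
    (hx₀ : ∀ w' : PlacesOver L v, Valued.v ((x₀ : LocalRing L v) w') = 1) {j : ℕ} (hj : 2 * d - 1 ≤ j) :
    ∫ c in {c : ↥(HeisRing.fixedPart (conjLocal L (IsCMField.complexConj L) v)) | Valued.v (((c : LocalRing L v) - x₀) w) ≤ Valued.v ϖ ^ j},
        (fun r : LocalRing L v => if h : IsUnit r then ((χ₁ h.unit : ℂˣ) : ℂ) else 0) (c : LocalRing L v) ∂ν =
      (ν.real {c : ↥(HeisRing.fixedPart (conjLocal L (IsCMField.complexConj L) v)) | Valued.v (((c : LocalRing L v) - x₀) w) ≤ Valued.v ϖ ^ j} : ℂ) *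
        ((χ₁ x₀ : ℂˣ) : ℂ) := by
  rw [setIntegral_congr_fun (measurableSet_nearBall L v w hD.2.2.1 (x₀ : LocalRing L v) j)
    (fun c hc => dite_eq_of_near L v w hw χ₁ hB hD x₀ hσx₀ hx₀ hj ((HeisRing.mem_fixedPart_iff _ _).1 c.2) hc),
    setIntegral_const, Complex.real_smul]

/-! ## §2 (M2) Shallow balls `j ≤ 2(d − 1)`: the mass of `E` vanishes -/

open scoped Classical in
include hw in
/-- **(M2) `∫_{x₀ + B⁺_j} E dν = 0` for `j ≤ 2(d − 1)`** (`x₀` any unit of modulus one, sub-branch (R-b): `hB`, `hFε`): the ★ (W-2) witness `u` (`σu = u`, `|u_w| = 1`, `u ≡ 1 (mod ϖ^{2(d−1)})`,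
`χ₁ u = −1`) satisfies `u·(x₀ + B⁺_j) = x₀ + B⁺_j` (ultrametric, `2(d−1) ≥ j`) and `c ↦ u·c` preserves `ν` (★ `measurePreserving_smulFixed_of_valued_eq_one`), while
`E(u·c) = χ₁(u)·E(c)` (★ `dite_chi_units_mul`); so the mass `I` satisfies `I = −I`.  The measure form of ★ `WildQuadraticDatum.sum_normSign_repr_eq_zero` (conductor EXACTLY `d`).
[cite: Serre1979, Ch. V §3 Prop. 5 Cor. 3; Ch. XV §2] [cite: WeilBNT1967, Ch. II §5] [cite: Keys1984, §7 Theorem (2) (d) p. 126] -/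
theorem setIntegral_nearBall_dite_eq_zero_of_le (χ₁ : (LocalRing L v)ˣ →* ℂˣ)
    (hB : ∀ u : (LocalRing L v)ˣ, (∀ w' : PlacesOver L v, Valued.v ((u : LocalRing L v) w') = 1) →
      χ₁ (u * Units.map (conjLocal L (IsCMField.complexConj L) v : LocalRing L v →* LocalRing L v) u) = 1)
    (hFε : ∃ a : (LocalRing L v)ˣ, Units.map (conjLocal L (IsCMField.complexConj L) v : LocalRing L v →* LocalRing L v) a = a ∧
      (∀ w' : PlacesOver L v, Valued.v ((a : LocalRing L v) w') = 1) ∧ χ₁ a ≠ 1)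
    {ϖ : w.1.adicCompletion L} {d t : ℕ} (hD : IsRamifiedQuadraticDatum (galAdicCompletionMap (L := L) (IsCMField.complexConj L) hw) ϖ d t)
    (x₀ : (LocalRing L v)ˣ) (hx₀ : ∀ w' : PlacesOver L v, Valued.v ((x₀ : LocalRing L v) w') = 1) {j : ℕ} (hj : j ≤ 2 * (d - 1)) :
    ∫ c in {c : ↥(HeisRing.fixedPart (conjLocal L (IsCMField.complexConj L) v)) | Valued.v (((c : LocalRing L v) - x₀) w) ≤ Valued.v ϖ ^ j},
        (fun r : LocalRing L v => if h : IsUnit r then ((χ₁ h.unit : ℂˣ) : ℂ) else 0) (c : LocalRing L v) ∂ν = 0 := by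
  have hϖ : Valued.v ϖ = WithZero.exp (-1 : ℤ) := hD.2.2.1
  obtain ⟨u, hσu, hu1, hul, hχu⟩ := exists_fixed_near_one_apply_eq_neg_one L v w hw χ₁ hB hFε hD
  have hσu' : conjLocal L (IsCMField.complexConj L) v (u : LocalRing L v) = u := by
    have h := congrArg (fun x : (LocalRing L v)ˣ => (x : LocalRing L v)) hσu
    simpa only [Units.coe_map, MonoidHom.coe_coe] using h
  have hulj : Valued.v (((u : LocalRing L v) - 1) w) ≤ Valued.v ϖ ^ j := by
    rw [Pi.sub_apply, Pi.one_apply]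
    exact hul.trans (varpi_pow_le_varpi_pow L v w hϖ hj)
  -- the inverse witness `u⁻¹` is `≡ 1 (mod ϖ^j)` too
  have huinv1 : Valued.v (((u⁻¹ : (LocalRing L v)ˣ) : LocalRing L v) w) = 1 := by
    rw [Units.val_inv_eq_inv_val, Pi.inv_apply, map_inv₀, hu1 w, inv_one]
  have hulj' : Valued.v ((((u⁻¹ : (LocalRing L v)ˣ) : LocalRing L v) - 1) w) ≤ Valued.v ϖ ^ j := by
    have e : (((u⁻¹ : (LocalRing L v)ˣ) : LocalRing L v) - 1) w = -((((u⁻¹ : (LocalRing L v)ˣ) : LocalRing L v) w) * (((u : LocalRing L v) - 1) w)) := by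
      have hne : (u : LocalRing L v) w ≠ 0 := fun h0 => zero_ne_one (by rw [← hu1 w, h0, map_zero])
      rw [Units.val_inv_eq_inv_val, Pi.sub_apply, Pi.sub_apply, Pi.inv_apply, Pi.one_apply]
      field_simp
      ring
    rw [e, Valuation.map_neg, map_mul, huinv1, one_mul]
    exact hulj
  -- the substitution `c ↦ u·c` maps the ball onto itself and preserves `ν`
  set T := HeisRing.smulFixed (conjLocal L (IsCMField.complexConj L) v) u hσu' with hT
  set B := {c : ↥(HeisRing.fixedPart (conjLocal L (IsCMField.complexConj L) v)) | Valued.v (((c : LocalRing L v) - x₀) w) ≤ Valued.v ϖ ^ j} with hB'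
  have hpre : T ⁻¹' B = B := by
    ext c
    rw [Set.mem_preimage, hB', Set.mem_setOf_eq, Set.mem_setOf_eq, hT, HeisRing.coe_smulFixed]
    refine ⟨fun h => ?_, fun h => valued_mul_sub_apply_le L v w (hu1 w) hulj (hx₀ w) h⟩
    have h' := valued_mul_sub_apply_le L v w huinv1 hulj' (hx₀ w) h
    rwa [Units.inv_mul_cancel_left] at h'
  have key := (measurePreserving_smulFixed_of_valued_eq_one L v w hw ν u hσu' (hu1 w)).setIntegral_preimage_emb T.toHomeomorph.measurableEmbedding
    (fun c : ↥(HeisRing.fixedPart (conjLocal L (IsCMField.complexConj L) v)) => (fun r : LocalRing L v => if h : IsUnit r then ((χ₁ h.unit : ℂˣ) : ℂ) else 0) (c : LocalRing L v)) B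
  rw [hpre] at key
  have hmul : ∀ c : ↥(HeisRing.fixedPart (conjLocal L (IsCMField.complexConj L) v)),
      (fun r : LocalRing L v => if h : IsUnit r then ((χ₁ h.unit : ℂˣ) : ℂ) else 0) ((T c : ↥(HeisRing.fixedPart _)) : LocalRing L v) =
        ((χ₁ u : ℂˣ) : ℂ) * (fun r : LocalRing L v => if h : IsUnit r then ((χ₁ h.unit : ℂˣ) : ℂ) else 0) (c : LocalRing L v) := by
    intro c
    rw [hT, HeisRing.coe_smulFixed]
    exact dite_chi_units_mul L v χ₁ u (c : LocalRing L v)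
  have key2 : ∫ c in B, ((χ₁ u : ℂˣ) : ℂ) * (fun r : LocalRing L v => if h : IsUnit r then ((χ₁ h.unit : ℂˣ) : ℂ) else 0) (c : LocalRing L v) ∂ν =
      ∫ c in B, (fun r : LocalRing L v => if h : IsUnit r then ((χ₁ h.unit : ℂˣ) : ℂ) else 0) (c : LocalRing L v) ∂ν :=
    (setIntegral_congr_fun (measurableSet_nearBall L v w hϖ (x₀ : LocalRing L v) j) (fun c _ => (hmul c).symm)).trans key
  rw [integral_const_mul, hχu, neg_one_mul] at key2
  -- `key2 : −I = I`
  have h2 : (2 : ℂ) * ∫ c in B, (fun r : LocalRing L v => if h : IsUnit r then ((χ₁ h.unit : ℂˣ) : ℂ) else 0) (c : LocalRing L v) ∂ν = 0 := by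
    linear_combination (-1 : ℂ) * key2
  exact (mul_eq_zero.1 h2).resolve_left two_ne_zero

/-! ## §3 The `x₀ = −1` readings: the wild thresholds `T_j = {e | |(1 + e)_w| ≤ |ϖ|^j}` of the Gauss-square split -/

omit [MeasurableSpace (LocalRing L v)] [BorelSpace (LocalRing L v)] in
/-- `T_j` is the ball around `−1`: `{e | |(1 + e)_w| ≤ γ} = {e | |(e − (−1))_w| ≤ γ}`. [cite: Serre1979, Ch. II §1] -/
private theorem setOf_one_add_eq (γ : WithZero (Multiplicative ℤ)) :
    {e : ↥(HeisRing.fixedPart (conjLocal L (IsCMField.complexConj L) v)) | Valued.v ((1 + (e : LocalRing L v)) w) ≤ γ} =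
      {e : ↥(HeisRing.fixedPart (conjLocal L (IsCMField.complexConj L) v)) | Valued.v (((e : LocalRing L v) - ((-1 : (LocalRing L v)ˣ) : LocalRing L v)) w) ≤ γ} := by
  ext e
  rw [Set.mem_setOf_eq, Set.mem_setOf_eq, Units.val_neg, Units.val_one, sub_neg_eq_add, add_comm]

open scoped Classical in
omit [ν.IsAddHaarMeasure] [ν.Regular] in
include hw in
/-- **`∫_{T_j} E dν = ν.real(T_j) · χ₁(−1)` for `j ≥ 2d − 1`**, `T_j = {e ∈ R⁺ | |(1 + e)_w| ≤ |ϖ|^j}` — the deep thresholds of the wild Gauss-square split (tame twin: ★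
`GaussSquareModLetters.setIntegral_fixedUnits_inter_dite_eq`, `T = −1 + 𝔪⁺`). [cite: Serre1979, Ch. XV §2] [cite: Keys1984, §4–§5] -/
theorem setIntegral_near_neg_one_dite_eq_of_le (χ₁ : (LocalRing L v)ˣ →* ℂˣ)
    (hB : ∀ u : (LocalRing L v)ˣ, (∀ w' : PlacesOver L v, Valued.v ((u : LocalRing L v) w') = 1) →
      χ₁ (u * Units.map (conjLocal L (IsCMField.complexConj L) v : LocalRing L v →* LocalRing L v) u) = 1)
    {ϖ : w.1.adicCompletion L} {d t : ℕ} (hD : IsRamifiedQuadraticDatum (galAdicCompletionMap (L := L) (IsCMField.complexConj L) hw) ϖ d t)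
    {j : ℕ} (hj : 2 * d - 1 ≤ j) :
    ∫ e in {e : ↥(HeisRing.fixedPart (conjLocal L (IsCMField.complexConj L) v)) | Valued.v ((1 + (e : LocalRing L v)) w) ≤ Valued.v ϖ ^ j},
        (fun r : LocalRing L v => if h : IsUnit r then ((χ₁ h.unit : ℂˣ) : ℂ) else 0) (e : LocalRing L v) ∂ν =
      (ν.real {e : ↥(HeisRing.fixedPart (conjLocal L (IsCMField.complexConj L) v)) | Valued.v ((1 + (e : LocalRing L v)) w) ≤ Valued.v ϖ ^ j} : ℂ) *
        ((χ₁ (-1) : ℂˣ) : ℂ) := by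
  rw [setOf_one_add_eq L v w]
  exact setIntegral_nearBall_dite_eq_of_le L v w hw ν χ₁ hB hD (-1)
    (Units.ext (by rw [Units.coe_map, MonoidHom.coe_coe, Units.val_neg, Units.val_one, map_neg, map_one]))
    (fun w' => by rw [Units.val_neg, Units.val_one, Pi.neg_apply, Pi.one_apply, Valuation.map_neg, map_one]) hj

open scoped Classical in
include hw in
/-- **`∫_{T_j} E dν = 0` for `j ≤ 2(d − 1)`** (`hB`, `hFε`), `T_j = {e ∈ R⁺ | |(1 + e)_w| ≤ |ϖ|^j}` — the shallow thresholds of the wild Gauss-square split carry no mass (tame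
`d = 1`: no such `j`). [cite: Serre1979, Ch. XV §2] [cite: Keys1984, §4–§5] -/
theorem setIntegral_near_neg_one_dite_eq_zero_of_le (χ₁ : (LocalRing L v)ˣ →* ℂˣ)
    (hB : ∀ u : (LocalRing L v)ˣ, (∀ w' : PlacesOver L v, Valued.v ((u : LocalRing L v) w') = 1) →
      χ₁ (u * Units.map (conjLocal L (IsCMField.complexConj L) v : LocalRing L v →* LocalRing L v) u) = 1)
    (hFε : ∃ a : (LocalRing L v)ˣ, Units.map (conjLocal L (IsCMField.complexConj L) v : LocalRing L v →* LocalRing L v) a = a ∧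
      (∀ w' : PlacesOver L v, Valued.v ((a : LocalRing L v) w') = 1) ∧ χ₁ a ≠ 1)
    {ϖ : w.1.adicCompletion L} {d t : ℕ} (hD : IsRamifiedQuadraticDatum (galAdicCompletionMap (L := L) (IsCMField.complexConj L) hw) ϖ d t)
    {j : ℕ} (hj : j ≤ 2 * (d - 1)) :
    ∫ e in {e : ↥(HeisRing.fixedPart (conjLocal L (IsCMField.complexConj L) v)) | Valued.v ((1 + (e : LocalRing L v)) w) ≤ Valued.v ϖ ^ j},
        (fun r : LocalRing L v => if h : IsUnit r then ((χ₁ h.unit : ℂˣ) : ℂ) else 0) (e : LocalRing L v) ∂ν = 0 := by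
  rw [setOf_one_add_eq L v w]
  exact setIntegral_nearBall_dite_eq_zero_of_le L v w hw ν χ₁ hB hFε hD (-1)
    (fun w' => by rw [Units.val_neg, Units.val_one, Pi.neg_apply, Pi.one_apply, Valuation.map_neg, map_one]) hj

end Haar

/-! ## §4 Corollary for the type side: in (R-b) the `E`-conductor of `χ₁` is at least `2δ + 1 = 2d − 1` -/

include hw in
/-- **`cond_E χ₁ ≥ 2δ + 1` IS AUTOMATIC IN (R-b)** (`δ = d − 1`): if `χ₁` is trivial on ALL units `u ≡ 1 (mod ϖ^n)` (the organ's `hcond` letter at level `n`, ★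
`K2E3ConcaveLevelIwahoriCharacterCM` spelling) then `2(d − 1) + 1 ≤ n` — otherwise the ★ (W-2) fixed witness `u ≡ 1 (mod ϖ^{2(d−1)})` with `χ₁ u = −1` would be killed.  This is the
`hn : 2 * δ + 1 ≤ n` letter of the (R-b) concave level datum ((W-3b)); with ★ (W-2) `apply_eq_one_of_fixed_of_valued_sub_one_le` (= `hcondF` at level `2d − 1`) it places the sub-branch
(R-b) EXACTLY at the threshold `a_F = d` of K2E3-p34 (a)(c). [cite: Serre1979, Ch. XV §2] [cite: Keys1984, §7 Theorem (2) (d) p. 126] [cite: Rogawski1990, §12.2 (2) p. 173] -/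
theorem two_mul_pred_add_one_le_of_cond (χ₁ : (LocalRing L v)ˣ →* ℂˣ)
    (hB : ∀ u : (LocalRing L v)ˣ, (∀ w' : PlacesOver L v, Valued.v ((u : LocalRing L v) w') = 1) →
      χ₁ (u * Units.map (conjLocal L (IsCMField.complexConj L) v : LocalRing L v →* LocalRing L v) u) = 1)
    (hFε : ∃ a : (LocalRing L v)ˣ, Units.map (conjLocal L (IsCMField.complexConj L) v : LocalRing L v →* LocalRing L v) a = a ∧
      (∀ w' : PlacesOver L v, Valued.v ((a : LocalRing L v) w') = 1) ∧ χ₁ a ≠ 1)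
    {ϖ : w.1.adicCompletion L} {d t : ℕ} (hD : IsRamifiedQuadraticDatum (galAdicCompletionMap (L := L) (IsCMField.complexConj L) hw) ϖ d t)
    {n : ℕ} (hcond : ∀ u : (LocalRing L v)ˣ, (∀ w' : PlacesOver L v, Valued.v (((u : LocalRing L v) w') - 1) ≤ Valued.v ϖ ^ n) → χ₁ u = 1) :
    2 * (d - 1) + 1 ≤ n := by
  haveI : Algebra.IsQuadraticExtension ↥(maximalRealSubfield L) L := IsCMField.isQuadraticExtension L
  haveI : Subsingleton (PlacesOver L v) :=
    PlacesOver.subsingleton_of_smul_eq (IsCMField.complexConj L) (IsCMField.complexConj_ne_one L) w hw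
  by_contra h
  push Not at h
  obtain ⟨u, -, -, hul, hχu⟩ := exists_fixed_near_one_apply_eq_neg_one L v w hw χ₁ hB hFε hD
  have h1 : χ₁ u = 1 := hcond u fun w' => by
    obtain rfl : w' = w := Subsingleton.elim _ _
    exact hul.trans (varpi_pow_le_varpi_pow L v w' hD.2.2.1 (by omega))
  rw [h1, Units.val_one] at hχu
  norm_num at hχu

end Summit.HodgeConjecture.HodgeConjecture.R90.S1.WildFixedUnitCharacterMasses

end
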